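import Summits.NavierStokesRegularity.NavierStokesRegularity.Theorems.ScenarioCensusRowF1WhirlTop
import HarnessLib

/-!
# LINE 42 «whirl-top» port, part 2/4: §4b analytic transport (LINE 41 BY NAME), the kills KW `eq_zero_of_whirl` and KP `eq_zero_of_precession`; limits with a MOVING APEX, the two defects and the
# two LEVELS (`whirl_limit` / `precession_limit`, `exists_whirlLevel` / `exists_precessionLevel`; LINE 40's `tendsto_eval` BY NAME)

Re-homed for the scenario census (typer seat ns-census-typer-1 g10; the cells F1gx / F1wx / F1qx / F1px and the floors WF / PF are members of row F1 «DECIDED IN KERNEL IN FILES» (LINE 42: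
ref ns-census-ref g15 PRE-CHECK ✓ §20.19, critic idea-crit-3 g10 PASS no price tier B 14:05:49Z, lead booking CANDIDATE 3/4 at v1.124 → of record with the critic's PASS); this port
makes them TREE-decided): VERBATIM PORT of ns-idea-3 LINE 42 «whirl-top», `pub/ideators/ns-idea-3/lines/whirl-top/line-whirl-top.lean` sha16 b777a0715a2eb784 (1320 l., lean check rc 0,
0 sorry), split for the 400-line rule into `ScenarioCensusRowF1WhirlTop` (§1–§4a) → `…WhirlTopKill` (§4b) → `…WhirlTopFloors` (§5) → `…WhirlTopRows` (§6–§7 + census KEYS).  Lean text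
VERBATIM in namespace `…Theorems.ScenarioCensus.WhirlTop` (the line's `…Cruxes.ScenarioCensusRowF1.WhirlTopLine` re-homed); port edits: the frame restated VERBATIM by the line from LINES
34–41 (`topSet`, `HasTypeIConstant`, `snapLevel`, `exists_fast_at`, `sqrt_mul_sq_mul`, `limitClass_compact`, `exists_level_of_limitKill`, `exists_witnessZoom_package`, `zoom_units`,
`eventually_forall_not_of_not_frequently`, `continuous_slice'`, `tendsto_eval`, `le_of_units`, `row_of_floor`, `rotLin`, `rotCLM`, `coe_rotCLM`, `analyticAt_rotZ`, `analyticAt_transport`, `rotZ_smul_eZ'`, `stream_fast`)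
is taken BY NAME from the landed two-time-top / one-level-top / snapshot-top / needle-top / echo-top / scaling-top / screw-top ports; elementary lemmas the line restates are the tree's BY
NAME (`rotZ_add_vec'` = `ScrewBlowdown.rotZ_add_vec`, `rotZ_add_smul_eZ'` = `ScrewBlowdown.rotZ_add_smul_eZ`, `rotZ_smul_vec'` = `rotZ_smul`, `rotZ_neg_rotZ'` = `rotZ_neg_apply_rotZ`,
`continuous_rotZ`, `continuous_rotZ_angle'` = `continuous_rotZ_angle`, `centre_mem` = `IsTypeIAncientMild.comp_add_right` (Literature.Analysis.FluidPDE), `rotZ_two_pi'` =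
`RotationOrder.rotZ_two_pi` (census rotation-order port), `addSubgroup_eq_univ_of_irrational_angle` / `forall_of_irrational_angle` = `SymmetricScarExists.RdssSplit.NearIdentity.…` — the
line's own header names the latter two as clones); `analyticAt_linIso` and `tendstoLocallyUniformly_comp_of_tendsto` (twins of lemmas in route-cone modules that are not imported) are not
re-declared — the former's one-line proof term is inlined; `@[conjecture]` on the residual `WhirlCollapse` (≡ `ScenarioCensus.Row_F1`, OPEN); one-line docstrings added where missing (gate
lint).  Statements untouched.

No census VALUE is moved here (row F1 stays OPEN-WITH-LINE; the members become TREE-decided by name); NS regularity is NOT proved; `Row_F1` is untouched (zero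
movement, `whirlCollapse_iff_rowF1`); no summit statement is proved by this file. Lemmas that restate already-landed tree declarations are taken BY NAME (gate lint `dedup.landed`): `topSet` = `TwoTimeTop.topSet`, `HasTypeIConstant` = `OneLevelTop.HasTypeIConstant`, `snapLevel` = `SnapshotTop.snapLevel`, `exists_fast_at` = `SnapshotTop.exists_fast_at`, `sqrt_mul_sq_mul` = `SnapshotTop.sqrt_mul_sq_mul`, `limitClass_compact` = `NeedleTop.limitClass_compact`, `exists_level_of_limitKill` = `NeedleTop.exists_level_of_limitKill`, `zoom_units` = `NeedleTop.zoom_units`, `exists_witnessZoom_package` = `EchoTop.exists_witnessZoom_package`, `eventually_forall_not_of_not_frequently` = `EchoTop.eventually_forall_not_of_not_frequently`, `centre_mem` = `IsTypeIAncientMild.comp_add_right`, `continuous_slice'` = `ScalingTop.continuous_slice'`, `tendsto_eval` = `ScalingTop.tendsto_eval`, `le_of_units` = `ScalingTop.le_of_units`, `rotZ_add_vec'` = `ScrewBlowdown.rotZ_add_vec`, `rotZ_smul_vec'` = `rotZ_smul`, `rotZ_add_smul_eZ'` = `ScrewBlowdown.rotZ_add_smul_eZ`, `rotLin` = `ScrewTop.rotLin`,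 `rotCLM` = `ScrewTop.rotCLM`, `analyticAt_rotZ` = `ScrewTop.analyticAt_rotZ`, `rotZ_neg_rotZ'` = `rotZ_neg_apply_rotZ`, `rotZ_two_pi'` = `RotationOrder.rotZ_two_pi`, `continuous_rotZ_angle'` = `continuous_rotZ_angle`, `addSubgroup_eq_univ_of_irrational_angle` = `SymmetricScarExists.RdssSplit.NearIdentity.addSubgroup_eq_top_of_irrational_angle`, `forall_of_irrational_angle` = `SymmetricScarExists.RdssSplit.NearIdentity.forall_of_irrational_angle_stabiliser`, `analyticAt_transport` = `ScrewTop.analyticAt_transport`, `rotZ_smul_eZ'` = `ScrewTop.rotZ_smul_eZ'`, `row_of_floor` = `ScalingTop.row_of_floor`, `stream_fast` = `ScrewTop.stream_fast`.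
-/

-- the summit and its single problem share the name `NavierStokesRegularity` (D-0017 nested layout)
set_option linter.dupNamespace false

noncomputable section

open MeasureTheory Set Function Filter TopologicalSpace Metric
open scoped Topology NNReal ENNReal InnerProductSpace

namespace Summit.NavierStokesRegularity.NavierStokesRegularity.Theorems.ScenarioCensus.WhirlTop

open Literature.Analysis Literature.Analysis.FluidPDE
open Summit.NavierStokesRegularity.NavierStokesRegularity.Theorems
open Summit.NavierStokesRegularity.NavierStokesRegularity.Theses
open Summit.NavierStokesRegularity.NavierStokesRegularity.Theorems.LocalHelicityTubeDoorFrobeniusProfileRigidityHelicalSlice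
open Summit.NavierStokesRegularity.NavierStokesRegularity.Theorems.NearExtremalTransiencePerFlow.FilamentSelection
open Summit.NavierStokesRegularity.NavierStokesRegularity.Theorems.LocalSineTubeDoorProfileAlignedWindowRigidityAncient

-- `analyticAt_transport`: the line restates the tree's `ScrewTop.analyticAt_transport`; taken BY NAME (gate lint dedup.landed).

/-- **(KW) A WHIRL POCKET OVER A GENERATING ANGLE SET KILLS.**  `W ∈ 𝒦_M`, a frame `L`, an apex `b`, a generating `Θ`, `a > 0`, and
`L⁻¹ W(−1, b + L(R_θ w)) = R_θ L⁻¹ W(−1, b + L w)` for `θ ∈ Θ`, `‖w‖ < a` (the snapshot is rotationally equivariant about the axis through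
`b` directed by `L e₂` through the angles of `Θ`, near the apex).  Then `W ≡ 0`: point continuation + angle generation make the transported
slice `y ↦ L⁻¹ W(−1, L y + b)` AXISYMMETRIC, and the tree's `eq_zero_of_conj_isAxisymmetric_oneSlice` (a member of `𝒦_M` with one slice
axisymmetric about any axis is trivial) is quoted BY NAME. -/
theorem eq_zero_of_whirl {M : ℝ} {W : ℝ → E3 → E3} (hW : IsTypeIAncientMild M W) (L : E3 ≃ₗᵢ[ℝ] E3) (b : E3)
    {Θ : Set ℝ} (hΘ : GeneratesAngles Θ) {a : ℝ} (ha : 0 < a)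
    (hrel : ∀ θ ∈ Θ, ∀ w ∈ ball (0 : E3) a,
      L.symm (W (-1) (b + L (rotZ θ w))) = rotZ θ (L.symm (W (-1) (b + L w)))) :
    ∀ s < 0, ∀ y : E3, W s y = 0 := by
  set V : E3 → E3 := fun y => L.symm (W (-1) (L y + b)) with hVdef
  have hall : ∀ θ ∈ Θ, ∀ y : E3, V (rotZ θ y) = rotZ θ (V y) := by
    intro θ hθ
    have hf : AnalyticOnNhd ℝ (fun y : E3 => V (rotZ θ y)) univ := fun y _ =>
      AnalyticAt.comp (g := V) (f := rotZ θ) (x := y) (ScrewTop.analyticAt_transport hW L b _) (ScrewTop.analyticAt_rotZ θ y)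
    have hg : AnalyticOnNhd ℝ (fun y : E3 => rotZ θ (V y)) univ := fun y _ =>
      AnalyticAt.comp (g := rotZ θ) (f := V) (x := y) (ScrewTop.analyticAt_rotZ θ _) (ScrewTop.analyticAt_transport hW L b y)
    have hev : (fun y : E3 => V (rotZ θ y)) =ᶠ[𝓝 (0 : E3)] fun y => rotZ θ (V y) := by
      filter_upwards [isOpen_ball.mem_nhds (mem_ball_self ha)] with w hw
      simp only [hVdef]
      rw [add_comm (L (rotZ θ w)) b, add_comm (L w) b]
      exact hrel θ hθ w hw
    have heq := hf.eqOn_of_preconnected_of_eventuallyEq hg isPreconnected_univ (mem_univ 0) hev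
    exact fun y => heq (mem_univ y)
  have hVc : Continuous V := continuous_iff_continuousAt.2 fun y => (ScrewTop.analyticAt_transport hW L b y).continuousAt
  have hax : IsAxisymmetric V := fun θ y => whirl_all_angles hVc hΘ hall θ y
  exact eq_zero_of_conj_isAxisymmetric_oneSlice hW L b (show (-1 : ℝ) < 0 by norm_num) hax

/-- **(KP) ONE LAGGED ISOMETRY KILLS (envelope transport).**  `W ∈ 𝒦_M`, a linear isometry `L`, an offset `d`, an apex `b`, a lag
`θ > 0`, `a > 0`, and `W(−1, b + (L w + d)) = L W(−1 − θ, b + w)` for `‖w‖ < a`.  Then `W ≡ 0`: point continuation; the field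
`V(s, y) = L W(s − θ, L⁻¹ y + (b − L⁻¹(b + d)))` is a member of `𝒦_M` with the SAME slice at `s = −1`, hence `V = W` on the open past
(tree `eq_of_slice_eq` BY NAME); so `‖W(s, ·)‖_∞ ≤ ‖W(s − θ, ·)‖_∞ ≤ … ≤ M/√(−s + nθ) → 0`. -/
theorem eq_zero_of_precession {M : ℝ} {W : ℝ → E3 → E3} (hW : IsTypeIAncientMild M W) (L : E3 ≃ₗᵢ[ℝ] E3) (d b : E3)
    {θ : ℝ} (hθ : 0 < θ) {a : ℝ} (ha : 0 < a)
    (hrel : ∀ w ∈ ball (0 : E3) a, W (-1) (b + (L w + d)) = L (W (-1 - θ) (b + w))) :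
    ∀ s < 0, ∀ y : E3, W s y = 0 := by
  have hm1 : (-1 : ℝ) < 0 := by norm_num
  have hm1θ : (-1 - θ : ℝ) < 0 := by linarith
  -- ## (1) point continuation: the relation holds for every `w`
  have hsl1 : AnalyticOnNhd ℝ (W (-1)) univ := hW.analyticOnNhd_slice_univ hm1
  have hsl2 : AnalyticOnNhd ℝ (W (-1 - θ)) univ := hW.analyticOnNhd_slice_univ hm1θ
  have hf : AnalyticOnNhd ℝ (fun w : E3 => W (-1) (b + (L w + d))) univ := fun w _ =>
    AnalyticAt.comp (g := W (-1)) (f := fun w : E3 => b + (L w + d)) (x := w) (hsl1 _ (mem_univ _))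
      (analyticAt_const.fun_add (((L.toContinuousLinearEquiv : E3 →L[ℝ] E3).analyticAt w).fun_add analyticAt_const))
  have hg : AnalyticOnNhd ℝ (fun w : E3 => L (W (-1 - θ) (b + w))) univ := fun w _ =>
    AnalyticAt.comp (g := fun z : E3 => L z) (f := fun w : E3 => W (-1 - θ) (b + w)) (x := w) ((L.toContinuousLinearEquiv : E3 →L[ℝ] E3).analyticAt _)
      (AnalyticAt.comp (g := W (-1 - θ)) (f := fun w : E3 => b + w) (x := w) (hsl2 _ (mem_univ _))
        (analyticAt_const.fun_add analyticAt_id))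
  have hev : (fun w : E3 => W (-1) (b + (L w + d))) =ᶠ[𝓝 (0 : E3)] fun w => L (W (-1 - θ) (b + w)) := by
    filter_upwards [isOpen_ball.mem_nhds (mem_ball_self ha)] with w hw
    exact hrel w hw
  have hall : ∀ w : E3, W (-1) (b + (L w + d)) = L (W (-1 - θ) (b + w)) := fun w =>
    hf.eqOn_of_preconnected_of_eventuallyEq hg isPreconnected_univ (mem_univ 0) hev (mem_univ w)
  -- ## (2) the lagged, moved copy `V` is a member of `𝒦_M` with the same slice at `s = -1`
  have hshift : IsTypeIAncientMild M (fun s => W (s - θ)) := hW.comp_sub_right hθ.le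
  have hV : IsTypeIAncientMild M (fun s y => L (W (s - θ) (L.symm y + (b - L.symm (b + d))))) := by
    simpa only [LinearIsometryEquiv.symm_symm] using isTypeIAncientMild_conj_affine hshift L.symm (b - L.symm (b + d))
  set V : ℝ → E3 → E3 := fun s y => L (W (s - θ) (L.symm y + (b - L.symm (b + d)))) with hVdef
  have hslice : V (-1) = W (-1) := by
    funext y
    have e := hall (L.symm (y - b - d))
    rw [LinearIsometryEquiv.apply_symm_apply, show b + (y - b - d + d) = y by abel] at e
    have e2 : L.symm y + (b - L.symm (b + d)) = b + L.symm (y - b - d) := by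
      simp only [map_sub, map_add]
      abel
    simp only [hVdef]
    rw [e2, ← e]
  -- ## (3) one slice determines the member: `V = W` on the open past
  have heq : ∀ s < 0, V s = W s :=
    eq_of_slice_eq hV.continuousOn_uncurry (bdd_of_hasTypeITimeDecay hV.hasTypeITimeDecay)
      (fun s t hst ht x => hV.mild_eq_heatExtension hst ht x) hW.continuousOn_uncurry
      (bdd_of_hasTypeITimeDecay hW.hasTypeITimeDecay) (fun s t hst ht x => hW.mild_eq_heatExtension hst ht x) hm1 hslice
  -- ## (4) envelope transport, iterated: `‖W(s, y)‖ ≤ M/√(−s + nθ)` for every `n`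
  have hiter : ∀ n : ℕ, ∀ s < 0, ∀ y : E3, ‖W s y‖ ≤ M / Real.sqrt (-s + n * θ) := by
    intro n
    induction n with
    | zero =>
      intro s hs y
      simpa using hW.norm_le hs y
    | succ n ih =>
      intro s hs y
      have hsθ : s - θ < 0 := by linarith
      have e : W s y = L (W (s - θ) (L.symm y + (b - L.symm (b + d)))) := by
        have h' := congrFun (heq s hs) y
        simpa only [hVdef] using h'.symm
      rw [e, LinearIsometryEquiv.norm_map]
      have h1 := ih (s - θ) hsθ (L.symm y + (b - L.symm (b + d)))
      have e2 : -(s - θ) + (n : ℝ) * θ = -s + ((n + 1 : ℕ) : ℝ) * θ := by push_cast; ring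
      rwa [e2] at h1
  -- ## (5) `n → ∞`
  intro s hs y
  have hlim : Tendsto (fun n : ℕ => M / Real.sqrt (-s + (n : ℝ) * θ)) atTop (𝓝 0) := by
    have h1 : Tendsto (fun n : ℕ => -s + (n : ℝ) * θ) atTop atTop :=
      tendsto_atTop_add_const_left _ _ (tendsto_natCast_atTop_atTop.atTop_mul_const hθ)
    exact tendsto_const_nhds.div_atTop (Real.tendsto_sqrt_atTop.comp h1)
  have hle : ‖W s y‖ ≤ 0 := ge_of_tendsto' hlim fun n => hiter n s hs y
  exact norm_le_zero_iff.1 hle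

/-! ### Limits with a MOVING APEX; the two defects; the two LEVELS (socket of §2 + limit + kill) -/

-- `tendsto_eval`: the line restates the tree's `ScalingTop.tendsto_eval`; taken BY NAME (gate lint dedup.landed).

/-- The **whirl defect below `Λ`** of `W` (frame `L`, angle set `Θ`, apex reach `A`, radius `a`): an apex `b`, `‖b‖ ≤ A`, with
`‖L⁻¹ W(−1, b + L(R_θ w)) − R_θ L⁻¹ W(−1, b + L w)‖ ≤ Λ` for `θ ∈ Θ`, `‖w‖ ≤ a`. -/
def WhirlDefectBelow (L : E3 ≃ₗᵢ[ℝ] E3) (Θ : Set ℝ) (A a Λ : ℝ) (W : ℝ → E3 → E3) : Prop :=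
  ∃ b ∈ closedBall (0 : E3) A, ∀ θ ∈ Θ, ∀ w ∈ closedBall (0 : E3) a,
    ‖L.symm (W (-1) (b + L (rotZ θ w))) - rotZ θ (L.symm (W (-1) (b + L w)))‖ ≤ Λ

/-- **Whirl limit** (moving apex): whirl defects `≤ δ_j` of fields `F_j` converging locally uniformly on slices to `W` (continuous
slices), `δ_j → δ₀`, give a whirl defect `≤ δ₀` of `W` (compactness of the apex ball, `ScalingTop.tendsto_eval`, continuity of `L⁻¹` and `R_θ`; the
angle set `Θ` is ARBITRARY — no compactness in the angle is needed, the estimate is pointwise in `θ`). -/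
theorem whirl_limit {L : E3 ≃ₗᵢ[ℝ] E3} {Θ : Set ℝ} {A a : ℝ} {F : ℕ → ℝ → E3 → E3} {W : ℝ → E3 → E3}
    (hWc : ∀ s < 0, Continuous (W s)) (hlu : ∀ s < 0, TendstoLocallyUniformly (fun j => F j s) (W s) atTop)
    {δ : ℕ → ℝ} {δ₀ : ℝ} (hδ : Tendsto δ atTop (𝓝 δ₀))
    (hdef : ∀ j, ∃ b ∈ closedBall (0 : E3) A, ∀ θ ∈ Θ, ∀ w ∈ closedBall (0 : E3) a,
      ‖L.symm (F j (-1) (b + L (rotZ θ w))) - rotZ θ (L.symm (F j (-1) (b + L w)))‖ ≤ δ j) :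
    WhirlDefectBelow L Θ A a δ₀ W := by
  choose b hb hdefb using hdef
  obtain ⟨b₀, hb₀, ψ, hψ, hlim⟩ := (isCompact_closedBall (0 : E3) A).tendsto_subseq hb
  refine ⟨b₀, hb₀, fun θ hθ w hw => ?_⟩
  have h1 : Tendsto (fun j => L.symm (F (ψ j) (-1) (b (ψ j) + L (rotZ θ w)))) atTop
      (𝓝 (L.symm (W (-1) (b₀ + L (rotZ θ w))))) :=
    (L.symm.continuous.tendsto _).comp
      (ScalingTop.tendsto_eval (hlu (-1) (by norm_num)) (hWc (-1) (by norm_num)) hψ (hlim.add tendsto_const_nhds))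
  have h2 : Tendsto (fun j => rotZ θ (L.symm (F (ψ j) (-1) (b (ψ j) + L w)))) atTop
      (𝓝 (rotZ θ (L.symm (W (-1) (b₀ + L w))))) :=
    ((continuous_rotZ θ).tendsto _).comp ((L.symm.continuous.tendsto _).comp
      (ScalingTop.tendsto_eval (hlu (-1) (by norm_num)) (hWc (-1) (by norm_num)) hψ (hlim.add tendsto_const_nhds)))
  exact le_of_tendsto_of_tendsto (h1.sub h2).norm (hδ.comp hψ.tendsto_atTop)
    (Eventually.of_forall fun j => hdefb (ψ j) θ hθ w hw)

/-- **THE WHIRL LEVEL `Λ₁(M, L, Θ, A, a, κ)`**: no `W ∈ 𝒦_M` with `‖W(−1, 0)‖ ≥ κ` has whirl defect below `Λ₁` (socket + whirl limit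
+ (KW)). -/
theorem exists_whirlLevel (M : ℝ) (L : E3 ≃ₗᵢ[ℝ] E3) {Θ : Set ℝ} (A a : ℝ) (hΘ : GeneratesAngles Θ) (ha : 0 < a)
    {κ : ℝ} (hκ : 0 < κ) :
    ∃ Λ₁ : ℝ, 0 < Λ₁ ∧ ∀ W : ℝ → E3 → E3, IsTypeIAncientMild M W → κ ≤ ‖W (-1) 0‖ →
      ¬ WhirlDefectBelow L Θ A a Λ₁ W := by
  refine NeedleTop.exists_level_of_limitKill M hκ (WhirlDefectBelow L Θ A a) ?_
  intro Wn W ε _ hεlim _ hW hP _ _ hlu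
  obtain ⟨b, -, hb⟩ := whirl_limit (fun s hs => ScalingTop.continuous_slice' hW hs) hlu hεlim hP
  have hrel : ∀ θ ∈ Θ, ∀ w ∈ ball (0 : E3) a,
      L.symm (W (-1) (b + L (rotZ θ w))) = rotZ θ (L.symm (W (-1) (b + L w))) := by
    intro θ hθ w hw
    have h0 := hb θ hθ w (ball_subset_closedBall hw)
    exact sub_eq_zero.1 (norm_le_zero_iff.1 h0)
  exact eq_zero_of_whirl hW L b hΘ ha hrel (-1) (by norm_num) 0

/-- The **precession defect below `Λ`** of `W` (isometry `L`, offset `d`, lag `θ`, apex reach `A`, radius `a`). -/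
def PrecessionDefectBelow (L : E3 ≃ₗᵢ[ℝ] E3) (d : E3) (θ A a Λ : ℝ) (W : ℝ → E3 → E3) : Prop :=
  ∃ b ∈ closedBall (0 : E3) A, ∀ w ∈ closedBall (0 : E3) a, ‖W (-1) (b + (L w + d)) - L (W (-1 - θ) (b + w))‖ ≤ Λ

/-- **Precession limit** (moving apex; two slices `−1` and `−1 − θ` of the open past). -/
theorem precession_limit {L : E3 ≃ₗᵢ[ℝ] E3} {d : E3} {θ A a : ℝ} (hθ : 0 < θ) {F : ℕ → ℝ → E3 → E3} {W : ℝ → E3 → E3}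
    (hWc : ∀ s < 0, Continuous (W s)) (hlu : ∀ s < 0, TendstoLocallyUniformly (fun j => F j s) (W s) atTop)
    {δ : ℕ → ℝ} {δ₀ : ℝ} (hδ : Tendsto δ atTop (𝓝 δ₀))
    (hdef : ∀ j, ∃ b ∈ closedBall (0 : E3) A, ∀ w ∈ closedBall (0 : E3) a,
      ‖F j (-1) (b + (L w + d)) - L (F j (-1 - θ) (b + w))‖ ≤ δ j) :
    PrecessionDefectBelow L d θ A a δ₀ W := by
  have hm : (-1 - θ : ℝ) < 0 := by linarith
  choose b hb hdefb using hdef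
  obtain ⟨b₀, hb₀, ψ, hψ, hlim⟩ := (isCompact_closedBall (0 : E3) A).tendsto_subseq hb
  refine ⟨b₀, hb₀, fun w hw => ?_⟩
  have h1 : Tendsto (fun j => F (ψ j) (-1) (b (ψ j) + (L w + d))) atTop (𝓝 (W (-1) (b₀ + (L w + d)))) :=
    ScalingTop.tendsto_eval (hlu (-1) (by norm_num)) (hWc (-1) (by norm_num)) hψ (hlim.add tendsto_const_nhds)
  have h2 : Tendsto (fun j => L (F (ψ j) (-1 - θ) (b (ψ j) + w))) atTop (𝓝 (L (W (-1 - θ) (b₀ + w)))) :=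
    (L.continuous.tendsto _).comp (ScalingTop.tendsto_eval (hlu (-1 - θ) hm) (hWc (-1 - θ) hm) hψ (hlim.add tendsto_const_nhds))
  exact le_of_tendsto_of_tendsto (h1.sub h2).norm (hδ.comp hψ.tendsto_atTop)
    (Eventually.of_forall fun j => hdefb (ψ j) w hw)

/-- **THE PRECESSION LEVEL `Λ₁(M, L, d, θ, A, a, κ)`** (socket + precession limit + (KP)). -/
theorem exists_precessionLevel (M : ℝ) (L : E3 ≃ₗᵢ[ℝ] E3) (d : E3) {θ : ℝ} (A a : ℝ) (hθ : 0 < θ) (ha : 0 < a)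
    {κ : ℝ} (hκ : 0 < κ) :
    ∃ Λ₁ : ℝ, 0 < Λ₁ ∧ ∀ W : ℝ → E3 → E3, IsTypeIAncientMild M W → κ ≤ ‖W (-1) 0‖ →
      ¬ PrecessionDefectBelow L d θ A a Λ₁ W := by
  refine NeedleTop.exists_level_of_limitKill M hκ (PrecessionDefectBelow L d θ A a) ?_
  intro Wn W ε _ hεlim _ hW hP _ _ hlu
  obtain ⟨b, -, hb⟩ := precession_limit hθ (fun s hs => ScalingTop.continuous_slice' hW hs) hlu hεlim hP
  have hrel : ∀ w ∈ ball (0 : E3) a, W (-1) (b + (L w + d)) = L (W (-1 - θ) (b + w)) := by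
    intro w hw
    have h0 := hb w (ball_subset_closedBall hw)
    exact sub_eq_zero.1 (norm_le_zero_iff.1 h0)
  exact eq_zero_of_precession hW L d b hθ ha hrel (-1) (by norm_num) 0

end Summit.NavierStokesRegularity.NavierStokesRegularity.Theorems.ScenarioCensus.WhirlTop

end
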